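import Summits.QuantumFields.YangMills.Theorems.BalabanUVNodesN21GappedPairRoadK3V6Knit
import Summits.QuantumFields.YangMills.Theorems.BalabanUVNodesN20GappedRoadCutZeroKnit
import Summits.QuantumFields.YangMills.Theorems.BalabanUVNodesN20KeyedRelWeightAnyCarriers

/-!
# N21 (NE7c) · THE PAIR ROAD AT THE ZERO CUT — N20, N21, N27x DISCHARGED BY NAME; what remains displayed is K4, (H-ζ), the dials, V6's «sign OR width zero» rows, node U5's
# Target off the live line, and N19′ = NE7 PROPER ON EVERY KEYED CLASS between the two runs' DOUBLY-GAPPED cores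

R134 seat `pub-ymgap-dag-n21-d` (g12, lane owner N21), strategy s2; key K3⁸ `SpineGivenEndpointR13SepCoPHV` = stmt-QuantumFields-27366, `--kind proof --supports 27366 --as helper`;
COUNT-NEUTRAL.  Theorems only (0 `def`).  The pair-road twin of dag-n20-w2 g5's `…N20GappedRoadCutZeroKnit` (p635103): V3 `…N21GappedPairRoadK3V6Knit` (p642482:
`keyedRelWeight_of_gap2Pin_of_witness`, `keyedShellWeight_of_gap2Pin`, `keyedExtraction_of_gap2Pin`, `keyedCoreEdgeHolderD4V_of_gap2Pin_of_witness`,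
`spineGivenEndpointR13SepCoPHV_of_gap2Road`), dag-n20-w2's `relWeightBound_classSet₁₃_cutZero` (ANY carriers, p633479) and `core_badClass₁₃_cutZero_of_allClasses` (p635103),
V1's `exists_reading_livePin` — all BY NAME; nothing re-typed.  [LF-I] = [Balaban1989LargeFieldI], [LF-II] = [Balaban1989LargeFieldII].

WHAT IS PROVED (kernel; [bookkeeping]; NO estimate): §6 `exists_relWeightBound_carriersGap2₁₃_cutZero` (N20's witness binder of V3 DISCHARGED at the cut reading `jc ≡ 0`: `W := 0`,
every dial quadruple) · `keyedRelWeight_of_gap2Pin_cutZero` (N20's v6 face on a reading pinned to `crGap2₁₃V 2 0 ρ ρ′ n₁ n₂` ∕ `crOneTerm₁₃ 0` is a THEOREM) · ★★★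
`spineGivenEndpointR13SepCoPHV_of_gap2Road_cutZero` (THE ROUTE DECL from K4 + N19′-on-every-keyed-class at the doubly-gapped cores + Target, under (H-ζ), the dials and V6's rows —
N20 ∕ N21 ∕ N27x by theorem) · `exists_gap2Pinned_faces_cutZero` (a reading so pinned carrying ALL FOUR K5 faces, three by theorem).

HONEST FRAMING (binding).  Compositions BY NAME; NO estimate of Bałaban's; NE7c at print's FIXED thresholds NOT PRINTED ∕ NOT proved; N19′'s all-classes NE7 sandwich between the
DOUBLY-GAPPED cores is a HYPOTHESIS (NE7 NOT PRINTED for `d = 4`), inhabited for no family (K0⁷ OPEN); (H-ζ) displayed (not derivable from the item's antecedents); NOT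
`stub_expansion13HV` (its `PinnedAtLive` names `crOfRecord₁₃V`); N21 NOT discharged at the v6 pin; K3⁸ NOT claimed; counts UNMOVED (typed 28∕28 · discharged 5∕27); never a count
claim.  No `sorry`, no `def`, no `instance`, no `notation`; standard axioms.  One finite four-torus programme at fixed `ε` — NOT ℝ⁴, NOT OS, NOT a mass gap, NOT the Clay problem.
-/

set_option autoImplicit false

noncomputable section

open scoped BigOperators

namespace Summit.QuantumFields.YangMills.Theorems.N21GappedRoadK3V6Knit

open Literature.MathematicalPhysics.QuantumFieldTheory.Balaban1983to89
open Literature.MathematicalPhysics.QuantumFieldTheory.Balaban1983to89.T4Continuum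
open Literature.MathematicalPhysics.QuantumFieldTheory.Balaban1983to89.Node00
open T4WeightBudget (RelWeightBound)
open T4ContinuumYM4Torus (ForSmallCouplings)
open Summit.QuantumFields.BalabanUV.T4Continuum.Spine
open YMDAG.UVSplit (SpineReading₁₃CoPH classSet₁₃ badClass₁₃ histA₁₃ histB₁₃)
open Summit.QuantumFields.YangMills.Theorems.K3V5Defs (SpineReading RateReadingFn CutReading KeyedRelWeight KeyedShellWeight LiveSel PHolderD4)
open Summit.QuantumFields.YangMills.Theorems.K3V6Defs (KeyedRatesHolderD4V KeyedCoreEdgeHolderD4V KeyedExtractionV)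
open Summit.QuantumFields.YangMills.BalabanUVNodes.N20OffLiveOneTermReading (crOneTerm₁₃)
open Summit.QuantumFields.YangMills.Theorems.N21ShellSplitOfRecord13CoPH (WidthLetter₁₃CoPH DepthLetter₁₃CoPH)
open Summit.QuantumFields.YangMills.Theorems.N21GappedTopPair13CoPH (crGap2₁₃V gapWeight2A₁₃ gapWeight2B₁₃ gapCore2A₁₃ gapCore2B₁₃)
open Summit.QuantumFields.YangMills.BalabanUVNodes.N20KeyedRelWeightAnyCarriers (relWeightBound_classSet₁₃_cutZero)
open Summit.QuantumFields.YangMills.BalabanUVNodes.N20GappedRoadCutZeroKnit (core_badClass₁₃_cutZero_of_allClasses)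

/-! ## §6 The pair road at the zero cut -/

section CutZero2

variable (ρ ρ' : WidthLetter₁₃CoPH 2) (n₁ n₂ : DepthLetter₁₃CoPH 2)

/-- **N20's WITNESS BINDER OF V3's PAIR-ROAD KNIT, DISCHARGED AT THE ZERO CUT** — for EVERY Stage-13 tuple with core provisos (guards unused), every dial quadruple: `W := 0`
(dag-n20-w2's `relWeightBound_classSet₁₃_cutZero`, any carriers; the persistence class `badClass₁₃ θ 0 g₀ (fun _ ↦ 0)` is empty). [bookkeeping] -/
theorem exists_relWeightBound_carriersGap2₁₃_cutZero :
    ∀ (F : T4Family) (θ : Stage13HParams F 2) (hP : θ.Provisos₁₃CoPH F 2), ((θ.ZhUnity F 2 ∧ θ.SlotsNondegenerate₁₃ F 2) ∧ LiveSel F θ) → θ.Admissible F 2 →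
      ∀ (g₀ : ℕ → ℝ) (os : List (ULoop F)),
        ∃ W : ℕ → ℝ, RelWeightBound 1 (classSet₁₃ θ 0 g₀)
          (gapWeight2A₁₃ θ hP 0 g₀ os (ρ F θ hP g₀ os) (ρ' F θ hP g₀ os) (n₁ F θ hP g₀ os) (n₂ F θ hP g₀ os))
          (gapWeight2B₁₃ θ hP 0 g₀ os (ρ F θ hP g₀ os) (ρ' F θ hP g₀ os) (n₁ F θ hP g₀ os) (n₂ F θ hP g₀ os))
          (badClass₁₃ θ 0 g₀ ((fun _ _ _ _ _ _ => 0 : CutReading) F θ hP g₀ os)) W :=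
  fun _ θ _ _ _ g₀ _ => ⟨fun _ => 0, relWeightBound_classSet₁₃_cutZero θ 0 g₀ 1 _ _⟩

/-- **N20's v6 FACE ON A READING PAIR-PINNED AT THE ZERO CUT IS A THEOREM**: `KeyedRelWeight cr` for `cr` pinned to `crGap2₁₃V 2 0 ρ ρ′ n₁ n₂` on the live line and to `crOneTerm₁₃ 0`
off it (V3's `keyedRelWeight_of_gap2Pin_of_witness` at the zero-cut witness). [bookkeeping] -/
theorem keyedRelWeight_of_gap2Pin_cutZero {cr : SpineReading}
    (hon : ∀ (F : T4Family) (θ : Stage13HParams F 2) (hP : θ.Provisos₁₃CoPH F 2) (g₀ : ℕ → ℝ) (os : List (ULoop F)),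
      LiveSel F θ → cr F θ hP g₀ os = crGap2₁₃V 2 ((fun _ _ _ _ _ _ => 0 : CutReading) F θ hP g₀ os) ρ ρ' n₁ n₂ F θ hP g₀ os)
    (hoff : ∀ (F : T4Family) (θ : Stage13HParams F 2) (hP : θ.Provisos₁₃CoPH F 2) (g₀ : ℕ → ℝ) (os : List (ULoop F)),
      ¬ LiveSel F θ → cr F θ hP g₀ os = crOneTerm₁₃ 0 F θ hP g₀ os) :
    KeyedRelWeight cr :=
  keyedRelWeight_of_gap2Pin_of_witness _ ρ ρ' n₁ n₂ hon hoff (exists_relWeightBound_carriersGap2₁₃_cutZero ρ ρ' n₁ n₂)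

/-- ★★★ **K3⁸ ON THE PAIR ROAD AT THE ZERO CUT, PIN-FREE — NO N20 LINE.**  Binder by binder: (H-ζ) on the guarded admissible tuples of the live-selector line; the dial rows
`0 ≤ ρ, ρ′ ≤ 1`, `Σ_K (1∕(n₁ K+1) + 1∕(n₂ K+1)) < ∞`; V6's satisfiable rows «(`0 ≤ ε_A ∧ 0 ≤ ε_B`) ∨ `ρ K = 0`», «(`0 ≤ δ_A ∧ 0 ≤ δ_B`) ∨ `ρ′ K = 0`»; K4 `KeyedRatesHolderD4V β rr`;
N19′ = for every slot `v`, under (B) → END → `ForSmallCouplings` and `PHolderD4 β`, «∃ summable `δ`, for every `K` ONE constant `c` with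
`e^{c − vol·δ_K}·gapCore2A ≤ gapCore2B ≤ e^{c + vol·δ_K}·gapCore2A` on EVERY keyed class, `|t| ≤ 1`» (NE7 proper between the two runs' DOUBLY-GAPPED cores — no top (3.2) statistic in
`(θ_{i⋆+2}, θ_{i⋆})` and no top (3.3) statistic in `(δ′_{j⋆+2}, δ′_{j⋆})` in either run; NOT PRINTED for `d = 4`); node U5's Target off the live line.  N20's witness is the zero-cut
theorem above; N21 ∕ N27x are V3's theorems (inside `spineGivenEndpointR13SepCoPHV_of_gap2Road`).  CONDITIONAL; NOT `stub_expansion13HV`; K3⁸ NOT claimed. [bookkeeping] -/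
theorem spineGivenEndpointR13SepCoPHV_of_gap2Road_cutZero (β : ℝ) (rr : RateReadingFn)
    (hζm : ∀ (F : T4Family) (θ : Stage13HParams F 2), θ.Provisos₁₃CoPH F 2 → ((θ.ZhUnity F 2 ∧ θ.SlotsNondegenerate₁₃ F 2) ∧ LiveSel F θ) → θ.Admissible F 2 →
      ZetaMeasurable F 2 θ.ζ)
    (hρ : ∀ (F : T4Family) (θ : Stage13HParams F 2) (hP : θ.Provisos₁₃CoPH F 2) (g₀ : ℕ → ℝ) (os : List (ULoop F)) (K : ℕ),
      (0 ≤ ρ F θ hP g₀ os K ∧ ρ F θ hP g₀ os K ≤ 1) ∧ (0 ≤ ρ' F θ hP g₀ os K ∧ ρ' F θ hP g₀ os K ≤ 1))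
    (hn : ∀ (F : T4Family) (θ : Stage13HParams F 2) (hP : θ.Provisos₁₃CoPH F 2) (g₀ : ℕ → ℝ) (os : List (ULoop F)),
      Summable (fun K => 1 / ((n₁ F θ hP g₀ os K : ℝ) + 1) + 1 / ((n₂ F θ hP g₀ os K : ℝ) + 1)))
    (hε : ∀ (F : T4Family) (θ : Stage13HParams F 2) (hP : θ.Provisos₁₃CoPH F 2) (g₀ : ℕ → ℝ) (os : List (ULoop F)) (K : ℕ),
      (0 ≤ epsOfRecord θ.ν (histA₁₃ θ 0 g₀ K) (0 + K) ∧ 0 ≤ epsOfRecord θ.ν (histB₁₃ θ 0 g₀ K) (0 + K + 1)) ∨ ρ F θ hP g₀ os K = 0)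
    (hδ : ∀ (F : T4Family) (θ : Stage13HParams F 2) (hP : θ.Provisos₁₃CoPH F 2) (g₀ : ℕ → ℝ) (os : List (ULoop F)) (K : ℕ),
      (0 ≤ deltaOfRecord θ.ν (histA₁₃ θ 0 g₀ K) (0 + K - 1) θ.A₁ ∧ 0 ≤ deltaOfRecord θ.ν (histB₁₃ θ 0 g₀ K) (0 + K) θ.A₁) ∨ ρ' F θ hP g₀ os K = 0)
    (hr : KeyedRatesHolderD4V β rr)
    (h19 : ∀ (F : T4Family) (θ : Stage13HParams F 2) (h : θ.Provisos₁₃SepCoPH F 2) (v : Revision₁₃ F 2 θ h),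
      ((θ.ZhUnity F 2 ∧ θ.SlotsNondegenerate₁₃ F 2) ∧ LiveSel F θ) → θ.Admissible F 2 →
      B16.EndStatementBPrinted (datumOfRecord₁₃SepCoPHV F 2 θ h v).C → DagBinding.EndpointExistence (datumOfRecord₁₃SepCoPHV F 2 θ h v).C.toB12 →
        ForSmallCouplings (datumOfRecord₁₃SepCoPHV F 2 θ h v) fun g₀ => ∀ os : List (ULoop F),
          PHolderD4 β (datumOfRecord₁₃SepCoPHV F 2 θ h v) (rr F θ h.toCore g₀ os) →
            ∃ δ : ℕ → ℝ, (∀ K : ℕ, ∃ c : ℝ, ∀ t : ℝ, |t| ≤ 1 → ∀ x ∈ classSet₁₃ θ 0 g₀ K,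
              Real.exp (c - F.side ^ 4 * δ K) *
                  gapCore2A₁₃ θ h.toCore 0 g₀ os (ρ F θ h.toCore g₀ os) (ρ' F θ h.toCore g₀ os) (n₁ F θ h.toCore g₀ os) (n₂ F θ h.toCore g₀ os) K t x ≤
                gapCore2B₁₃ θ h.toCore 0 g₀ os (ρ F θ h.toCore g₀ os) (ρ' F θ h.toCore g₀ os) (n₁ F θ h.toCore g₀ os) (n₂ F θ h.toCore g₀ os) K t x ∧
              gapCore2B₁₃ θ h.toCore 0 g₀ os (ρ F θ h.toCore g₀ os) (ρ' F θ h.toCore g₀ os) (n₁ F θ h.toCore g₀ os) (n₂ F θ h.toCore g₀ os) K t x ≤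
                Real.exp (c + F.side ^ 4 * δ K) *
                  gapCore2A₁₃ θ h.toCore 0 g₀ os (ρ F θ h.toCore g₀ os) (ρ' F θ h.toCore g₀ os) (n₁ F θ h.toCore g₀ os) (n₂ F θ h.toCore g₀ os) K t x) ∧ Summable δ)
    (htarget : ∀ (F : T4Family) (θ : Stage13HParams F 2) (hP : θ.Provisos₁₃CoPH F 2), ((θ.ZhUnity F 2 ∧ θ.SlotsNondegenerate₁₃ F 2) ∧ ¬ LiveSel F θ) → θ.Admissible F 2 →
      ∀ (g₀ : ℕ → ℝ) (os : List (ULoop F)), PHolderD4 β (datumOfRecord₁₃CoPH F 2 θ hP) (rr F θ hP g₀ os) →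
        ∃ δ : ℕ → ℝ, NE7.Target ((F.side : ℝ) ^ 4) 1 δ (fun K => T4GenFunBounds.schemeZ ((datumOfRecord₁₃CoPH F 2 θ hP).scheme g₀) os (0 + K))) :
    Summit.QuantumFields.YangMills.Theses.BalabanUVNodes.SpineGivenEndpointR13SepCoPHV := by
  refine spineGivenEndpointR13SepCoPHV_of_gap2Road β rr (fun _ _ _ _ _ _ => 0) ρ ρ' n₁ n₂ hζm hρ hn hε hδ hr
    (exists_relWeightBound_carriersGap2₁₃_cutZero ρ ρ' n₁ n₂) (fun F θ h v hG hθ hB hE => ?_) htarget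
  refine ForSmallCouplings.mono (fun g₀ h' os hPr => ?_) (h19 F θ h v hG hθ hB hE)
  obtain ⟨δ, hδ', hsum⟩ := h' os hPr
  letI : DecidableEq (Σ K, SiteSeqKey F (0 + K)) := Classical.decEq _
  exact ⟨δ, core_badClass₁₃_cutZero_of_allClasses θ g₀ hδ', hsum⟩

/-- ★★ **UNDER A PAIR PIN AT THE ZERO CUT THERE IS A SPINE READING CARRYING ALL FOUR K5 FACES OF STUB 2's BODY — THREE BY THEOREM** (N20: the zero-cut witness; N21 ∕ N27x: V3's),
the fourth (N19′) from the all-classes NE7 binder + node U5's Target off the live line; rows (H-ζ), the dials, V6's rows.  The registered pin is the plan's; this is the kernel form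
of the pair alternative at `jc ≡ 0`, nothing more. [bookkeeping] -/
theorem exists_gap2Pinned_faces_cutZero (β : ℝ) (rr : RateReadingFn)
    (hζm : ∀ (F : T4Family) (θ : Stage13HParams F 2), θ.Provisos₁₃CoPH F 2 → ((θ.ZhUnity F 2 ∧ θ.SlotsNondegenerate₁₃ F 2) ∧ LiveSel F θ) → θ.Admissible F 2 →
      ZetaMeasurable F 2 θ.ζ)
    (hρ : ∀ (F : T4Family) (θ : Stage13HParams F 2) (hP : θ.Provisos₁₃CoPH F 2) (g₀ : ℕ → ℝ) (os : List (ULoop F)) (K : ℕ),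
      (0 ≤ ρ F θ hP g₀ os K ∧ ρ F θ hP g₀ os K ≤ 1) ∧ (0 ≤ ρ' F θ hP g₀ os K ∧ ρ' F θ hP g₀ os K ≤ 1))
    (hn : ∀ (F : T4Family) (θ : Stage13HParams F 2) (hP : θ.Provisos₁₃CoPH F 2) (g₀ : ℕ → ℝ) (os : List (ULoop F)),
      Summable (fun K => 1 / ((n₁ F θ hP g₀ os K : ℝ) + 1) + 1 / ((n₂ F θ hP g₀ os K : ℝ) + 1)))
    (hε : ∀ (F : T4Family) (θ : Stage13HParams F 2) (hP : θ.Provisos₁₃CoPH F 2) (g₀ : ℕ → ℝ) (os : List (ULoop F)) (K : ℕ),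
      (0 ≤ epsOfRecord θ.ν (histA₁₃ θ 0 g₀ K) (0 + K) ∧ 0 ≤ epsOfRecord θ.ν (histB₁₃ θ 0 g₀ K) (0 + K + 1)) ∨ ρ F θ hP g₀ os K = 0)
    (hδ : ∀ (F : T4Family) (θ : Stage13HParams F 2) (hP : θ.Provisos₁₃CoPH F 2) (g₀ : ℕ → ℝ) (os : List (ULoop F)) (K : ℕ),
      (0 ≤ deltaOfRecord θ.ν (histA₁₃ θ 0 g₀ K) (0 + K - 1) θ.A₁ ∧ 0 ≤ deltaOfRecord θ.ν (histB₁₃ θ 0 g₀ K) (0 + K) θ.A₁) ∨ ρ' F θ hP g₀ os K = 0)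
    (h19 : ∀ (F : T4Family) (θ : Stage13HParams F 2) (h : θ.Provisos₁₃SepCoPH F 2) (v : Revision₁₃ F 2 θ h),
      ((θ.ZhUnity F 2 ∧ θ.SlotsNondegenerate₁₃ F 2) ∧ LiveSel F θ) → θ.Admissible F 2 →
      B16.EndStatementBPrinted (datumOfRecord₁₃SepCoPHV F 2 θ h v).C → DagBinding.EndpointExistence (datumOfRecord₁₃SepCoPHV F 2 θ h v).C.toB12 →
        ForSmallCouplings (datumOfRecord₁₃SepCoPHV F 2 θ h v) fun g₀ => ∀ os : List (ULoop F),
          PHolderD4 β (datumOfRecord₁₃SepCoPHV F 2 θ h v) (rr F θ h.toCore g₀ os) →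
            ∃ δ : ℕ → ℝ, (∀ K : ℕ, ∃ c : ℝ, ∀ t : ℝ, |t| ≤ 1 → ∀ x ∈ classSet₁₃ θ 0 g₀ K,
              Real.exp (c - F.side ^ 4 * δ K) *
                  gapCore2A₁₃ θ h.toCore 0 g₀ os (ρ F θ h.toCore g₀ os) (ρ' F θ h.toCore g₀ os) (n₁ F θ h.toCore g₀ os) (n₂ F θ h.toCore g₀ os) K t x ≤
                gapCore2B₁₃ θ h.toCore 0 g₀ os (ρ F θ h.toCore g₀ os) (ρ' F θ h.toCore g₀ os) (n₁ F θ h.toCore g₀ os) (n₂ F θ h.toCore g₀ os) K t x ∧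
              gapCore2B₁₃ θ h.toCore 0 g₀ os (ρ F θ h.toCore g₀ os) (ρ' F θ h.toCore g₀ os) (n₁ F θ h.toCore g₀ os) (n₂ F θ h.toCore g₀ os) K t x ≤
                Real.exp (c + F.side ^ 4 * δ K) *
                  gapCore2A₁₃ θ h.toCore 0 g₀ os (ρ F θ h.toCore g₀ os) (ρ' F θ h.toCore g₀ os) (n₁ F θ h.toCore g₀ os) (n₂ F θ h.toCore g₀ os) K t x) ∧ Summable δ)
    (htarget : ∀ (F : T4Family) (θ : Stage13HParams F 2) (hP : θ.Provisos₁₃CoPH F 2), ((θ.ZhUnity F 2 ∧ θ.SlotsNondegenerate₁₃ F 2) ∧ ¬ LiveSel F θ) → θ.Admissible F 2 →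
      ∀ (g₀ : ℕ → ℝ) (os : List (ULoop F)), PHolderD4 β (datumOfRecord₁₃CoPH F 2 θ hP) (rr F θ hP g₀ os) →
        ∃ δ : ℕ → ℝ, NE7.Target ((F.side : ℝ) ^ 4) 1 δ (fun K => T4GenFunBounds.schemeZ ((datumOfRecord₁₃CoPH F 2 θ hP).scheme g₀) os (0 + K))) :
    ∃ cr : SpineReading,
      (∀ (F : T4Family) (θ : Stage13HParams F 2) (hP : θ.Provisos₁₃CoPH F 2) (g₀ : ℕ → ℝ) (os : List (ULoop F)),
        LiveSel F θ → cr F θ hP g₀ os = crGap2₁₃V 2 (fun _ => 0) ρ ρ' n₁ n₂ F θ hP g₀ os) ∧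
      (∀ (F : T4Family) (θ : Stage13HParams F 2) (hP : θ.Provisos₁₃CoPH F 2) (g₀ : ℕ → ℝ) (os : List (ULoop F)),
        ¬ LiveSel F θ → cr F θ hP g₀ os = crOneTerm₁₃ 0 F θ hP g₀ os) ∧
      KeyedRelWeight cr ∧ KeyedShellWeight cr ∧ KeyedExtractionV cr ∧ KeyedCoreEdgeHolderD4V β cr rr := by
  obtain ⟨cr, hon, hoff⟩ :=
    exists_reading_livePin (fun F θ hP g₀ os => crGap2₁₃V 2 ((fun _ _ _ _ _ _ => 0 : CutReading) F θ hP g₀ os) ρ ρ' n₁ n₂ F θ hP g₀ os)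
  refine ⟨cr, hon, hoff, keyedRelWeight_of_gap2Pin_cutZero ρ ρ' n₁ n₂ hon hoff, keyedShellWeight_of_gap2Pin _ ρ ρ' n₁ n₂ hon hoff hζm hρ hn hε hδ,
    (keyedExtraction_of_gap2Pin _ ρ ρ' n₁ n₂ hon hoff hζm).2,
    keyedCoreEdgeHolderD4V_of_gap2Pin_of_witness _ ρ ρ' n₁ n₂ hon hoff hζm β rr hρ hn hε hδ (fun F θ h v hG hθ hB hE => ?_) htarget⟩
  refine ForSmallCouplings.mono (fun g₀ h' os hPr => ?_) (h19 F θ h v hG hθ hB hE)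
  obtain ⟨δ, hδ', hsum⟩ := h' os hPr
  letI : DecidableEq (Σ K, SiteSeqKey F (0 + K)) := Classical.decEq _
  exact ⟨δ, core_badClass₁₃_cutZero_of_allClasses θ g₀ hδ', hsum⟩

end CutZero2

end Summit.QuantumFields.YangMills.Theorems.N21GappedRoadK3V6Knit

end
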